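import Mathlib.Analysis.InnerProductSpace.Calculus
import Mathlib.Analysis.InnerProductSpace.PiL2
import Mathlib.Analysis.Calculus.Deriv.Inv
import Mathlib.Analysis.Calculus.Deriv.Mul
import Mathlib.Analysis.Calculus.Deriv.Comp
import Mathlib.Analysis.Calculus.Deriv.Add
import Mathlib.Analysis.Calculus.Deriv.Pow
import Mathlib.Analysis.SpecialFunctions.Sqrt
import HarnessLib

/-!
# Plane and space calculus for the transported torus coordinate (layer T of brick F3, part 1)

Auxiliary file (layer T.1) of the registered layer `helper_f3_transport` of stub
`helper_sliceGluing_bottConstruction` (apex brick F3), line `Sketch`, crux `SblfDescent.RungOne`.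

(Crux item stmt-SmoothPoincare4-18531; skeleton `Cruxes/RungOne/Lines/Sketch.lean`.)

The transported coordinate `a` of layer T is `A ∘ Π`, where `Π` pushes points up to a torus
level along the flow of a vector field `Z` with `dh(Z) = 1` (unit speed in the height
`h = ⟪f, v⟫`) and `du(Z) = 0` (the longitude `u = (f₀, f₁)/‖(f₀, f₁)‖` is a first integral),
which inside the fold tube `ν` is the radial field `(2ρ²)⁻¹ (y₀ ∂₀ + y₁ ∂₁)` of the normal
coordinates.  Such a field is found locally by lifting constant vectors through auxiliary
submersions and glued by a partition of unity (Bröcker–Jänich (1982), proof of (8.12)); the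
constraints are AFFINE in `Z`, written with the functionals of this file:

* `F3T.cross`, `F3T.pdot`, `F3T.angRatio c` (the tangent `⟪p, Jc⟫/⟪p, c⟫` of the angle from
  `c`), `F3T.unitVec` (`p/‖p‖`), with their derivatives along lines
  (`F3T.fderiv_angRatio_apply`, `F3T.fderiv_unitVec_eq_zero_of_cross`: a derivative `q` with
  `p × q = 0` does not turn the direction `p/‖p‖`);
* Euler's relation `Dg(p) p = 0` for functions constant along rays
  (`F3T.fderiv_apply_smul_self_eq_zero`), derivatives along lines.

The radial model in `ℝ³` (the field inside the tube) is in the companion file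
`SblfDescentRungOneHelperF3TRad.lean`.

## References

* Th. Bröcker, K. Jänich, *Introduction to Differential Topology*, CUP 1982, (8.12) (proof).
  [BrockerJanichIDT1982]
* J. Milnor, *Morse theory*, Ann. of Math. Studies 51 (1963), proof of Thm. 3.1. [Milnor1963]
-/

set_option linter.dupNamespace false

noncomputable section

open scoped ContDiff Topology
open Set Filter
open scoped RealInnerProductSpace

namespace Summit.SmoothPoincare4.SmoothPoincare4.Cruxes.RungOne.Sketch

namespace F3T

/-! ### Derivatives along lines; homogeneous functions -/

section Line

variable {V W : Type*} [NormedAddCommGroup V] [NormedSpace ℝ V] [NormedAddCommGroup W]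
  [NormedSpace ℝ W]

/-- The derivative of `t ↦ g (p + t q)` at `0` is `Dg(p) q`. [folklore] -/
theorem hasDerivAt_comp_line {g : V → W} {p : V} {L : V →L[ℝ] W} (hg : HasFDerivAt g L p)
    (q : V) : HasDerivAt (fun t : ℝ => g (p + t • q)) (L q) 0 := by
  have h1 : HasDerivAt (fun t : ℝ => p + t • q) ((1 : ℝ) • q) 0 :=
    ((hasDerivAt_id (0 : ℝ)).smul_const q).const_add p
  rw [one_smul] at h1
  have h2 : HasFDerivAt g L (p + (0 : ℝ) • q) := by rw [zero_smul, add_zero]; exact hg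
  exact h2.comp_hasDerivAt (0 : ℝ) h1

/-- **Euler's relation for a function constant along rays**: if `g (t p) = g p` for `t` near
`1` and `g` is differentiable at `p`, then `Dg(p) (μ p) = 0`. [folklore] -/
theorem fderiv_apply_smul_self_eq_zero {g : V → W} {p : V} (hg : DifferentiableAt ℝ g p)
    (hhom : ∀ᶠ t in 𝓝 (1 : ℝ), g (t • p) = g p) (μ : ℝ) : fderiv ℝ g p (μ • p) = 0 := by
  have h1 : HasDerivAt (fun t : ℝ => g (t • p)) (fderiv ℝ g p p) 1 := by
    have hl : HasDerivAt (fun t : ℝ => t • p) ((1 : ℝ) • p) 1 := (hasDerivAt_id (1 : ℝ)).smul_const p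
    rw [one_smul] at hl
    have hg' : HasFDerivAt g (fderiv ℝ g p) ((1 : ℝ) • p) := by
      rw [one_smul]; exact hg.hasFDerivAt
    exact hg'.comp_hasDerivAt (1 : ℝ) hl
  have h2 : HasDerivAt (fun t : ℝ => g (t • p)) 0 1 :=
    (hasDerivAt_const (1 : ℝ) (g p)).congr_of_eventuallyEq hhom
  rw [map_smul, h1.unique h2, smul_zero]

end Line

/-! ### Plane vectors in coordinates -/

/-- The planar cross product `p₀ q₁ - p₁ q₀`. [folklore] -/
def cross (p q : EuclideanSpace ℝ (Fin 2)) : ℝ := p 0 * q 1 - p 1 * q 0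

/-- The planar dot product in coordinates `p₀ q₀ + p₁ q₁`. [folklore] -/
def pdot (p q : EuclideanSpace ℝ (Fin 2)) : ℝ := p 0 * q 0 + p 1 * q 1

/-- `‖p‖² = p₀² + p₁²`. [folklore] -/
theorem norm_sq_eq_two (p : EuclideanSpace ℝ (Fin 2)) : ‖p‖ ^ 2 = p 0 ^ 2 + p 1 ^ 2 := by
  rw [EuclideanSpace.norm_sq_eq, Fin.sum_univ_two, Real.norm_eq_abs, Real.norm_eq_abs, sq_abs,
    sq_abs]

/-- `pdot p p = ‖p‖²`. [folklore] -/
theorem pdot_self (p : EuclideanSpace ℝ (Fin 2)) : pdot p p = ‖p‖ ^ 2 := by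
  rw [norm_sq_eq_two, pdot]; ring

/-- `cross p p = 0`. [folklore] -/
@[simp] theorem cross_self (p : EuclideanSpace ℝ (Fin 2)) : cross p p = 0 := by
  rw [cross]; ring

/-- `cross` is linear in the second slot. [folklore] -/
theorem cross_add_smul (p q r : EuclideanSpace ℝ (Fin 2)) (t : ℝ) :
    cross p (q + t • r) = cross p q + t * cross p r := by
  simp only [cross, PiLp.add_apply, PiLp.smul_apply, smul_eq_mul]; ring

/-- `pdot` is linear in the second slot. [folklore] -/
theorem pdot_add_smul (p q r : EuclideanSpace ℝ (Fin 2)) (t : ℝ) :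
    pdot p (q + t • r) = pdot p q + t * pdot p r := by
  simp only [pdot, PiLp.add_apply, PiLp.smul_apply, smul_eq_mul]; ring

/-- `cross p (t q) = t cross p q`. [folklore] -/
theorem cross_smul (p q : EuclideanSpace ℝ (Fin 2)) (t : ℝ) : cross p (t • q) = t * cross p q := by
  simp only [cross, PiLp.smul_apply, smul_eq_mul]; ring

/-- `pdot p (t q) = t pdot p q`. [folklore] -/
theorem pdot_smul (p q : EuclideanSpace ℝ (Fin 2)) (t : ℝ) : pdot p (t • q) = t * pdot p q := by
  simp only [pdot, PiLp.smul_apply, smul_eq_mul]; ring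

/-- A nonzero plane vector has `pdot p p ≠ 0`. [folklore] -/
theorem pdot_self_ne_zero {p : EuclideanSpace ℝ (Fin 2)} (hp : p ≠ 0) : pdot p p ≠ 0 := by
  rw [pdot_self]; exact pow_ne_zero 2 (norm_ne_zero_iff.2 hp)

/-- `pdot` is the inner product. [folklore] -/
theorem pdot_eq_inner (p q : EuclideanSpace ℝ (Fin 2)) : pdot p q = ⟪p, q⟫ := by
  rw [PiLp.inner_apply, Fin.sum_univ_two, pdot]
  simp only [RCLike.inner_apply, conj_trivial]
  ring

/-- The inner product of `ℝ³` in coordinates. [folklore] -/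
theorem inner_eq_three (y w : EuclideanSpace ℝ (Fin 3)) : ⟪y, w⟫ = y 0 * w 0 + y 1 * w 1 + y 2 * w 2 := by
  rw [PiLp.inner_apply, Fin.sum_univ_three]
  simp only [RCLike.inner_apply, conj_trivial]
  ring

/-- A vector orthogonal and parallel to a nonzero `p` vanishes. [folklore] -/
theorem eq_zero_of_pdot_cross {p q : EuclideanSpace ℝ (Fin 2)} (hp : p ≠ 0) (h1 : pdot p q = 0)
    (h2 : cross p q = 0) : q = 0 := by
  have hpp := pdot_self_ne_zero hp
  unfold pdot cross at *
  have hq0 : q 0 * (p 0 * p 0 + p 1 * p 1) = 0 := by linear_combination (p 0) * h1 - (p 1) * h2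
  have hq1 : q 1 * (p 0 * p 0 + p 1 * p 1) = 0 := by linear_combination (p 1) * h1 + (p 0) * h2
  ext i; fin_cases i
  · exact (mul_eq_zero.1 hq0).resolve_right hpp
  · exact (mul_eq_zero.1 hq1).resolve_right hpp

/-- `cross p (J p) = ‖p‖²` for the quarter turn `J p = (-p₁, p₀)`. [folklore] -/
theorem cross_perp (p : EuclideanSpace ℝ (Fin 2)) : cross p !₂[-p 1, p 0] = pdot p p := by
  simp [cross, pdot]
  try ring

/-- `pdot p (J p) = 0`. [folklore] -/
theorem pdot_perp (p : EuclideanSpace ℝ (Fin 2)) : pdot p !₂[-p 1, p 0] = 0 := by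
  simp [pdot]
  try ring

/-- **Parallel vectors**: if `p ≠ 0` and `p × q = 0` then `q = (⟪p, q⟫/‖p‖²) p`. [folklore] -/
theorem eq_smul_of_cross_eq_zero {p q : EuclideanSpace ℝ (Fin 2)} (hp : p ≠ 0) (h : cross p q = 0) :
    q = (pdot p q / pdot p p) • p := by
  have hpp := pdot_self_ne_zero hp
  unfold cross at h
  ext i
  fin_cases i
  · show q 0 = (pdot p q / pdot p p) • p 0
    rw [smul_eq_mul, div_mul_eq_mul_div, eq_div_iff hpp, pdot, pdot]
    linear_combination (-(p 1)) * h
  · show q 1 = (pdot p q / pdot p p) • p 1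
    rw [smul_eq_mul, div_mul_eq_mul_div, eq_div_iff hpp, pdot, pdot]
    linear_combination (p 0) * h

/-! ### The angle ratio `⟪p, Jc⟫ / ⟪p, c⟫` -/

/-- **The angle ratio** `angRatio c p = (c × p)/(c · p)`, the tangent of the angle from `c` to
`p`: a local coordinate of the direction of `p` on the half-plane `{c · p > 0}`. [folklore] -/
def angRatio (c p : EuclideanSpace ℝ (Fin 2)) : ℝ := cross c p / pdot c p

/-- The coordinates of `ℝ²` are smooth. [folklore] -/
theorem contDiff_apply_two (i : Fin 2) : ContDiff ℝ ∞ fun p : EuclideanSpace ℝ (Fin 2) => p i :=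
  (EuclideanSpace.proj (𝕜 := ℝ) i).contDiff

/-- `p ↦ cross c p` is smooth. [folklore] -/
theorem contDiff_cross (c : EuclideanSpace ℝ (Fin 2)) : ContDiff ℝ ∞ fun p => cross c p := by
  unfold cross
  exact (contDiff_const.mul (contDiff_apply_two 1)).sub (contDiff_const.mul (contDiff_apply_two 0))

/-- `p ↦ pdot c p` is smooth. [folklore] -/
theorem contDiff_pdot (c : EuclideanSpace ℝ (Fin 2)) : ContDiff ℝ ∞ fun p => pdot c p := by
  unfold pdot
  exact (contDiff_const.mul (contDiff_apply_two 0)).add (contDiff_const.mul (contDiff_apply_two 1))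

/-- The angle ratio is smooth off the line `c · p = 0`. [folklore] -/
theorem contDiffAt_angRatio {c p : EuclideanSpace ℝ (Fin 2)} (h : pdot c p ≠ 0) :
    ContDiffAt ℝ ∞ (angRatio c) p :=
  (contDiff_cross c).contDiffAt.div (contDiff_pdot c).contDiffAt h

/-- The angle ratio is constant along rays. [folklore] -/
theorem angRatio_smul {c p : EuclideanSpace ℝ (Fin 2)} {t : ℝ} (ht : t ≠ 0) :
    angRatio c (t • p) = angRatio c p := by
  rw [angRatio, angRatio, cross_smul, pdot_smul, mul_div_mul_left _ _ ht]

/-- The derivative of the angle ratio along the line `p + t q`: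
`d/dt|₀ = ‖c‖² (p × q) / (c · p)²`. [folklore] -/
theorem hasDerivAt_angRatio_line {c p : EuclideanSpace ℝ (Fin 2)} (h : pdot c p ≠ 0)
    (q : EuclideanSpace ℝ (Fin 2)) :
    HasDerivAt (fun t : ℝ => angRatio c (p + t • q)) (pdot c c * cross p q / pdot c p ^ 2) 0 := by
  have hn : HasDerivAt (fun t : ℝ => cross c p + t * cross c q) (1 * cross c q) 0 :=
    ((hasDerivAt_id (0 : ℝ)).mul_const (cross c q)).const_add (cross c p)
  have hd : HasDerivAt (fun t : ℝ => pdot c p + t * pdot c q) (1 * pdot c q) 0 :=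
    ((hasDerivAt_id (0 : ℝ)).mul_const (pdot c q)).const_add (pdot c p)
  have hdiv := hn.div hd (by rw [zero_mul, add_zero]; exact h)
  have heq : (fun t : ℝ => angRatio c (p + t • q)) =
      fun t => (cross c p + t * cross c q) / (pdot c p + t * pdot c q) := by
    funext t; rw [angRatio, cross_add_smul, pdot_add_smul]
  rw [heq]
  refine hdiv.congr_deriv ?_
  simp only [zero_mul, add_zero, one_mul]
  rw [pdot, pdot, pdot, cross, cross, cross]
  field_simp
  ring

/-- **The differential of the angle ratio**: `D(angRatio c)(p) q = ‖c‖² (p × q)/(c · p)²`; in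
particular its kernel is the line of `p`. [folklore] -/
theorem fderiv_angRatio_apply {c p : EuclideanSpace ℝ (Fin 2)} (h : pdot c p ≠ 0)
    (q : EuclideanSpace ℝ (Fin 2)) :
    fderiv ℝ (angRatio c) p q = pdot c c * cross p q / pdot c p ^ 2 :=
  (hasDerivAt_comp_line ((contDiffAt_angRatio h).differentiableAt (by simp)).hasFDerivAt q).unique
    (hasDerivAt_angRatio_line h q)

/-! ### The direction `p / ‖p‖` -/

/-- **The direction** `unitVec p = p/‖p‖`. [folklore] -/
def unitVec (p : EuclideanSpace ℝ (Fin 2)) : EuclideanSpace ℝ (Fin 2) := ‖p‖⁻¹ • p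

/-- `‖p/‖p‖‖ = 1` for `p ≠ 0`. [folklore] -/
theorem norm_unitVec {p : EuclideanSpace ℝ (Fin 2)} (hp : p ≠ 0) : ‖unitVec p‖ = 1 :=
  norm_smul_inv_norm hp

/-- The direction is constant along open rays. [folklore] -/
theorem unitVec_smul {p : EuclideanSpace ℝ (Fin 2)} {t : ℝ} (ht : 0 < t) :
    unitVec (t • p) = unitVec p := by
  by_cases hp : p = 0
  · simp [unitVec, hp]
  · rw [unitVec, unitVec, norm_smul, Real.norm_eq_abs, abs_of_pos ht, smul_smul]
    congr 1
    field_simp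

/-- The direction of a unit vector is itself. [folklore] -/
theorem unitVec_of_norm_eq_one {p : EuclideanSpace ℝ (Fin 2)} (hp : ‖p‖ = 1) : unitVec p = p := by
  rw [unitVec, hp, inv_one, one_smul]

/-- The direction map is smooth off the origin. [folklore] -/
theorem contDiffAt_unitVec {p : EuclideanSpace ℝ (Fin 2)} (hp : p ≠ 0) : ContDiffAt ℝ ∞ unitVec p :=
  ((contDiffAt_norm ℝ hp).inv (norm_ne_zero_iff.2 hp)).smul contDiffAt_id

/-- **A derivative parallel to `p` does not turn the direction**: `D(unitVec)(p) (μ p) = 0`.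
[folklore] -/
theorem fderiv_unitVec_apply_smul {p : EuclideanSpace ℝ (Fin 2)} (hp : p ≠ 0) (μ : ℝ) :
    fderiv ℝ unitVec p (μ • p) = 0 := by
  refine fderiv_apply_smul_self_eq_zero ((contDiffAt_unitVec hp).differentiableAt (by simp)) ?_ μ
  filter_upwards [lt_mem_nhds (zero_lt_one' ℝ)] with t ht
  exact unitVec_smul ht

/-- `D(unitVec)(p) q = 0` whenever `p × q = 0` (`p ≠ 0`). [folklore] -/
theorem fderiv_unitVec_eq_zero_of_cross {p q : EuclideanSpace ℝ (Fin 2)} (hp : p ≠ 0)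
    (h : cross p q = 0) : fderiv ℝ unitVec p q = 0 := by
  rw [eq_smul_of_cross_eq_zero hp h]; exact fderiv_unitVec_apply_smul hp _

end F3T

end Summit.SmoothPoincare4.SmoothPoincare4.Cruxes.RungOne.Sketch

end
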